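import Summits.ResolutionOfSingularities.ResolutionOfSingularities.Theorems.PurelyInseparableDim4JointTree
import Summits.ResolutionOfSingularities.ResolutionOfSingularities.Theorems.PurelyInseparableDim4ChartCentreClosed
import HarnessLib

/-!
# Purely inseparable four-folds: the JOINT TREE from the ROOT — finitely many pairwise separated translated coordinate
# centres of `z^p + F` plus isolated points, hypotheses on `F` only (brick S3 (c) «joint point∘coordinate chains»,
# part 8, cell `res-dim4-pi`)

[OURS · counted 0] (D-0157 DOOR 2; desk WORD #66 (4)(c), #74 (g); frame `PIDim4.TerminationImpliesOrderReduction`,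
S3 (c); host item stmt-ResolutionOfSingularities-16155, helper). Nothing here proves resolution of singularities in
dimension ≥ 4 / characteristic `p` — NOT here, not anywhere in this programme.

The root instance of part 7's `exists_isMarkedResolution_of_joint_config` (`X = X′ = 𝔸⁵_K`, `σ = 𝟙`). An INITIAL
COORDINATE MEMBER of `z^p + F` is a pair `(b, S)`: a parameter `b ∈ K⁴` and a centre set `S` such that `V(z, x_S)` is
Hironaka-permissible for the RE-CENTRED CLEANED equation `z^p + deletePthPowers p (F(x + b))`; its support is the
translated subspace `{x_i = b_i (i ∈ S)}` of the hypersurface (in cleaned coordinates `z_b = 0`). Two members `(b, S)`,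
`(b′, S′)` are SEPARATED if `b_i ≠ b′_i` for some `i ∈ S ∩ S′` (⟺ their supports are disjoint).

* §1 `exists_chart_recenter_full` — typ-3 g2's re-centring chart `Spec Θ_b` (translation to `((−F(b))^{1/p}, b)` and
  Hauser cleaning) with the extra facts the tree needs: it is SURJECTIVE (an automorphism), CLOSED, and reads the
  translated coordinates (`x_i − b_i ∈ 𝔭_{φ y} ⟺ x_i ∈ 𝔭_y`);
* §2 `root_member_package` — the member `(b, S)` as a coordinate member of part 7 on `(𝔸⁵, (z^p + F)·𝒪, [], p)`:
  a closed set `c_b` (typ-2's `closureImage`), regular, snc with the empty boundary, zigzag chart `(Spec Θ_b, 𝟙)` reading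
  `hypSheaf p (deletePthPowers p (F(x + b)))` and `𝓘Λ S`, with the coordinate description of its points (every point
  of `c_b` has `x_i − b_i ∈ 𝔭` for `i ∈ S`; every CLOSED point of the hypersurface with `x|_S = b|_S` lies in `c_b`);
* §3 **`exists_isMarkedResolution_joint_root`** — `K = K̄` of characteristic `p`, `F ≠ 0` clean; a finite set `mem`
  of pairwise separated initial coordinate members, each with finitely many equimultiple pairs and well-founded,
  finitely branching point walks below every successor; the root parameters `b′` off all members
  (`¬ b′|_S = b|_S` for every `(b, S) ∈ mem`) finite, each with a well-founded finitely branching point walk below its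
  re-centred state ⇒ `(𝔸⁵_K, (z^p + F)·𝒪, [], p)` admits a marked resolution (BGMW Def. 3.1.3) — the conclusion of
  `PIDim4.OrderReduction p` for `F`, by the joint tree (coordinate members first, in any order, then points).

AI-produced formalisation, weaker than expert review. bears_on: LADDER-RESOLUTION:D157-DOOR2 (res-dim4-pi · S3 (c) joint).
-/

set_option linter.dupNamespace false -- D-0017: single-problem summit path `Summit.<S>.<S>.…` by design

noncomputable section

open MvPolynomial Finset CategoryTheory AlgebraicGeometry Opposite TopologicalSpace
open AlgebraicGeometry.Scheme.IdealSheafData (ofIdealTop vanishingIdeal)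

namespace Summit.ResolutionOfSingularities.ResolutionOfSingularities.Theorems.PIDim4

open Literature.AlgebraicGeometry.Resolution
open Literature.AlgebraicGeometry.Resolution.Hauser2010
open Literature.AlgebraicGeometry.Resolution.AffinePointBlowup (P A γ coord Wtop ξ)

namespace Equimultiple

/-! ## §1 The re-centring chart, with surjectivity and the coordinate reading -/

section Recenter

variable {K : Type} [Field K] {p : ℕ} [hp : Fact p.Prime] [CharP K p]

/-- **ROOT CHART BY RE-CENTRING (full form).** As `exists_chart_recenter` (translation to the rational point `(a, b)` of
`V(z^p + F)` followed by Hauser's cleaning), recording moreover that the chart `φ = Spec Θ` is SURJECTIVE and CLOSED (an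
automorphism of `𝔸⁵_K`) and reads the translated coordinates: `x_i − b_i ∈ 𝔭_{φ y} ⟺ x_i ∈ 𝔭_y`.
[cite: Hauser2010, §G (cleaning of p-th power monomials)] [cite: HauserPerlega2019PRIMS, §2 (cleaning z ↦ z − F(b)^{1/p})] -/
theorem exists_chart_recenter_full [PerfectRing K p] (F : MvPolynomial (Fin 4) K) (a : K) (b : Fin 4 → K)
    (hab : a ^ p + MvPolynomial.eval b F = 0) {x : P 4 K}
    (hx : x.asIdeal = MvPolynomial.vanishingIdeal K {(Fin.cons a b : Fin (4 + 1) → K)}) :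
    ∃ (φ : P 4 K ⟶ P 4 K) (_ : IsOpenImmersion φ), Function.Surjective φ ∧ φ (ξ 4 K) = x ∧
      (hypSheaf p F).comap φ = hypSheaf p (deletePthPowers p (PointBlowup.translate b F)) ∧
      (∀ (y : P 4 K) (i : Fin 4), (X i.succ - C (b i) : A 4 K) ∈ (φ y).asIdeal ↔ (X i.succ : A 4 K) ∈ y.asIdeal) ∧
      ∀ T : Set (P 4 K), IsClosed T → IsClosed (φ '' T) := by
  obtain ⟨θ, h, h0, hs, hθ⟩ :=
    ChartDictionary.exists_clean_hyp_eq_deletePthPowers_pow (K := K) p 1 (PointBlowup.translate b F + C (a ^ p))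
  rw [pow_one] at hθ
  have hθ' := ChartDictionary.clean_hyp p h0 hs 1 (PointBlowup.translate b F + C (a ^ p))
  rw [pow_one] at hθ'
  have hG0 : constantCoeff (PointBlowup.translate b F + C (a ^ p)) = 0 := by
    rw [map_add, constantCoeff_C, show constantCoeff (PointBlowup.translate b F) = MvPolynomial.eval b F from
      coeff_zero_translate b F, add_comm]
    exact hab
  have hh0 : constantCoeff h = 0 := by
    have h1 : PointBlowup.translate b F + C (a ^ p) + h ^ p =
        deletePthPowers p (PointBlowup.translate b F + C (a ^ p)) := hyp_injective (hθ'.symm.trans hθ)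
    have h2 := congrArg constantCoeff h1
    rw [map_add, hG0, zero_add, constantCoeff_deletePthPowers, map_pow] at h2
    exact pow_eq_zero_iff (hp.out.ne_zero) |>.mp h2
  have hGhyp : (X 0 ^ p + C (a ^ p) + rename Fin.succ (PointBlowup.translate b F) : A 4 K) =
      hyp p (PointBlowup.translate b F + C (a ^ p)) := by
    rw [hyp, map_add, rename_C, add_assoc, add_comm (C (a ^ p))]
  let τ : A 4 K ≃ₐ[K] A 4 K := translateEquiv (Fin.cons a b : Fin (4 + 1) → K)
  let Θ : A 4 K ≃ₐ[K] A 4 K := τ.trans θ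
  have hτ : ∀ g : A 4 K, τ g = PointBlowup.translate (Fin.cons a b : Fin (4 + 1) → K) g := fun g => rfl
  have hΘ0 : Θ (X 0) = X 0 + rename Fin.succ (h + C a) := by
    change θ (τ (X 0)) = _
    rw [hτ, PointBlowup.translate, aeval_X, Fin.cons_zero, map_add, h0, show θ (C a) = C a from θ.commutes a,
      map_add, rename_C, add_assoc]
  have hΘs : ∀ i : Fin 4, Θ (X i.succ) = X i.succ + C (b i) := by
    intro i
    change θ (τ (X i.succ)) = _
    rw [hτ, PointBlowup.translate, aeval_X, Fin.cons_succ, map_add, hs i, show θ (C (b i)) = C (b i) from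
      θ.commutes (b i)]
  have hΘF : Θ (hyp p F) = hyp p (deletePthPowers p (PointBlowup.translate b F)) := by
    change θ (τ (hyp p F)) = _
    rw [hτ, translate_hyp, hGhyp, hθ, deletePthPowers_add_C]
  haveI := isOpenImmersion_specMap_algEquiv Θ
  haveI : IsIso (CommRingCat.ofHom (Θ : A 4 K →+* A 4 K)) :=
    (inferInstance : IsIso Θ.toRingEquiv.toCommRingCatIso.hom)
  refine ⟨Spec.map (CommRingCat.ofHom (Θ : A 4 K →+* A 4 K)), inferInstance,
    (Spec.map (CommRingCat.ofHom (Θ : A 4 K →+* A 4 K))).surjective, ?_, ?_, fun y i => ?_,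
    fun T hT => (Spec.map (CommRingCat.ofHom (Θ : A 4 K →+* A 4 K))).isClosedMap _ hT⟩
  · apply PrimeSpectrum.ext
    rw [specMap_algEquiv_ξ_asIdeal Θ (h + C a) b hΘ0 hΘs, hx, map_add, hh0, constantCoeff_C, zero_add]
  · rw [ChartDictionary.comap_hypSheaf_specMap, show (Θ : A 4 K →+* A 4 K) (hyp p F) = Θ (hyp p F) from rfl, hΘF]
    rfl
  · rw [Spec.map_apply, PrimeSpectrum.comap_asIdeal, Ideal.mem_comap, CommRingCat.hom_ofHom]
    change Θ (X i.succ - C (b i)) ∈ y.asIdeal ↔ _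
    rw [map_sub, hΘs i, show Θ (C (b i)) = C (b i) from Θ.commutes (b i), add_sub_cancel_right]

end Recenter

/-! ## §2 An initial coordinate member of `z^p + F` as a coordinate member of the joint tree -/

section RootMember

variable {K : Type} [Field K] {p : ℕ} [hp : Fact p.Prime] [CharP K p]

/-- **ROOT MEMBER PACKAGE.** `K = K̄` of characteristic `p`, `(b, S)` an initial coordinate member of `z^p + F`
(`V(z, x_S)` Hironaka-permissible for `z^p + deletePthPowers p (F(x + b))`). There is a closed set `c ⊆ 𝔸⁵_K` — the
translated coordinate subspace `{z_b = 0, x_i = b_i (i ∈ S)}` of the hypersurface — carrying the data of a COORDINATE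
MEMBER of part 7 for `(𝔸⁵, (z^p + F)·𝒪, [], p)` with state `(deletePthPowers p (F(x + b)), 0, ∅)` and centre set `S`,
together with its coordinate description: every point of `c` has `x_i − b_i ∈ 𝔭` (`i ∈ S`), and every CLOSED point of
the hypersurface `V(z^p + F)` (order `≥ 1`) with `x_i − b_i ∈ 𝔭` (`i ∈ S`) lies in `c`.
[cite: HauserPerlega2019PRIMS, §2 (permissible centres P = (z, x_i : i ∈ Γ))] [cite: Hauser2010, §G] -/
theorem root_member_package [IsAlgClosed K] [DecidableEq K] (F : MvPolynomial (Fin 4) K) (b : Fin 4 → K)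
    {S : Finset (Fin 4)} (hS : IsPermissibleCentre p S (deletePthPowers p (PointBlowup.translate b F))) :
    ∃ c : Closeds (P 4 K),
      Scheme.IsRegular (vanishingIdeal c).subscheme ∧
      HasSNCWith ((⟨hypSheaf p F, [], p⟩ : MarkedIdeal (P 4 K)).boundary) (vanishingIdeal c) ∧
      (∃ (Y : Scheme.{0}) (φ : Y ⟶ P 4 K) (ψ : Y ⟶ P 4 K) (_ : IsOpenImmersion φ) (_ : IsOpenImmersion ψ),
        (⟨hypSheaf p F, [], p⟩ : MarkedIdeal (P 4 K)).ideal.comap φ =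
          (hypSheaf p (⟨deletePthPowers p (PointBlowup.translate b F), 0, ∅⟩ : State K).F).comap ψ ∧
        (vanishingIdeal c).comap φ = (AffineCoordBlowup.𝓘Λ 4 K (insert 0 (Fin.succ '' (S : Set (Fin 4))))).comap ψ ∧
        (c : Set (P 4 K)) ⊆ Set.range φ ∧
        (AffineCoordBlowup.CΛ 4 K (insert 0 (Fin.succ '' (S : Set (Fin 4)))) : Set (P 4 K)) ⊆ Set.range ψ) ∧
      (∀ z : P 4 K, z ∈ (c : Set (P 4 K)) → ∀ i ∈ S, (X i.succ - C (b i) : A 4 K) ∈ z.asIdeal) ∧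
      (∀ z : P 4 K, IsClosed ({z} : Set (P 4 K)) → (1 : ℕ∞) ≤ idealOrder (hypSheaf p F) z →
        (∀ i ∈ S, (X i.succ - C (b i) : A 4 K) ∈ z.asIdeal) → z ∈ (c : Set (P 4 K))) := by
  haveI : PerfectRing K p := PerfectRing.ofSurjective K p fun x => IsAlgClosed.exists_pow_nat_eq x hp.out.pos
  -- the rational point `(a, b)` of the hypersurface and its re-centring chart
  obtain ⟨a, hab, -⟩ := existsUnique_pow_add_eq_zero (K := K) (p := p) (MvPolynomial.eval b F)
  let x : P 4 K := ⟨MvPolynomial.vanishingIdeal K {(Fin.cons a b : Fin (4 + 1) → K)}, inferInstance⟩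
  obtain ⟨φ, _, hsurj, -, hMφ, hcoord, hclosedMap⟩ := exists_chart_recenter_full (p := p) F a b hab (x := x) rfl
  set Λ : Set (Fin (4 + 1)) := insert 0 (Fin.succ '' (S : Set (Fin 4))) with hΛ
  have hT : IsClosed (φ '' (AffineCoordBlowup.CΛ 4 K Λ : Set (P 4 K))) := hclosedMap _ (AffineCoordBlowup.CΛ 4 K Λ).isClosed
  set c : Closeds (P 4 K) := closureImage φ ((AffineCoordBlowup.𝓘Λ 4 K Λ).support : Set (P 4 K)) with hc
  have hcoe : (c : Set (P 4 K)) = φ '' (AffineCoordBlowup.CΛ 4 K Λ : Set (P 4 K)) := by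
    rw [hc, coe_closureImage, AffineCoordBlowup.support_𝓘Λ, hT.closure_eq]
  have hE₀ : HasSNC ((⟨hypSheaf p F, [], p⟩ : MarkedIdeal (P 4 K)).boundary) :=
    hasSNC_nil_of_isRegular (Literature.AlgebraicGeometry.Hironaka2017.Lib.AffinePointBlowupLSB.isRegular_Z 4 K)
  refine ⟨c, ChartDictionary.isRegular_globalCentre φ hT,
    ChartDictionary.hasSNCWith_globalCentre φ hT hE₀ (ChartDictionary.hasSNCWith_nil_𝓘Λ Λ),
    ⟨P 4 K, φ, 𝟙 _, inferInstance, inferInstance, by rw [Scheme.IdealSheafData.comap_id]; exact hMφ,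
      by rw [Scheme.IdealSheafData.comap_id, hc]; exact ChartDictionary.comap_globalCentre φ Λ,
      fun z _ => hsurj z, fun y _ => ⟨y, rfl⟩⟩, fun z hz i hi => ?_, fun z hzc hord hzS => ?_⟩
  · -- points of the member have `x_i = b_i`, `i ∈ S`
    rw [hcoe] at hz
    obtain ⟨y, hy, rfl⟩ := hz
    exact (hcoord y i).mpr ((AffineCoordBlowup.mem_CΛ_iff' 4 K Λ y).mp hy i.succ
      (ChartDictionary.succ_mem_centreVars hi))
  · -- closed points of the hypersurface with `x_i = b_i` (`i ∈ S`) lie on the member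
    rw [hcoe]
    obtain ⟨y, rfl⟩ := hsurj z
    refine ⟨y, ?_, rfl⟩
    have hyc : IsClosed ({y} : Set (P 4 K)) := isClosed_singleton_of_isOpenImmersion_eq φ y hzc rfl
    obtain ⟨a', b', hy⟩ := exists_eq_vanishingIdeal_cons_of_isClosed hyc
    have hyS : ∀ i ∈ S, b' i = 0 := fun i hi =>
      (X_succ_mem_asIdeal_iff i a' b' hy).mp ((hcoord y i).mp (hzS i hi))
    -- on the chart the hypersurface reads `z^p + G_b`, `G_b ∈ (x_S)^p`; so `a' = 0`
    have hord' : (1 : ℕ∞) ≤ idealOrder (hypSheaf p (deletePthPowers p (PointBlowup.translate b F))) y := by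
      rw [← hMφ, idealOrder_comap_of_isOpenImmersion]
      exact hord
    have h1 := (natCast_le_idealOrder_hypSheaf_iff (p := p) (deletePthPowers p (PointBlowup.translate b F)) hy 1).mp
      (by exact_mod_cast hord')
    rw [Nat.cast_one, translate_hyp, one_le_ordZero_iff, map_add, map_add, map_pow, constantCoeff_X,
      zero_pow hp.out.ne_zero, zero_add, constantCoeff_C, constantCoeff_rename,
      show constantCoeff (PointBlowup.translate b' (deletePthPowers p (PointBlowup.translate b F))) =
        MvPolynomial.eval b' (deletePthPowers p (PointBlowup.translate b F)) from coeff_zero_translate b' _,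
      eval_eq_zero_of_one_le_ordAlong (le_trans (by exact_mod_cast hp.out.one_lt.le) hS.2) hyS, add_zero] at h1
    have ha' : a' = 0 := pow_eq_zero_iff hp.out.ne_zero |>.mp h1
    exact mem_CΛ_of_cons hy ha' hyS

end RootMember

/-! ## §3 The joint tree from the root -/

section Root

variable {K : Type} [Field K] {p : ℕ} [hp : Fact p.Prime] [CharP K p]

omit hp [CharP K p] in
/-- At the rational point `(a, b)`: `x_i − u ∈ 𝔭 ⟺ b_i = u`. [folklore] -/
theorem X_succ_sub_C_mem_asIdeal_iff (i : Fin 4) (u a : K) (b : Fin 4 → K) {x : P 4 K}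
    (hx : x.asIdeal = MvPolynomial.vanishingIdeal K {(Fin.cons a b : Fin (4 + 1) → K)}) :
    (X i.succ - C u : A 4 K) ∈ x.asIdeal ↔ b i = u := by
  rw [hx, MvPolynomial.mem_vanishingIdeal_singleton_iff, map_sub, aeval_X, aeval_C, Fin.cons_succ, sub_eq_zero]
  exact Iff.rfl

/-- **THE JOINT TREE FROM THE ROOT (hypotheses on `F` only).** See the module docstring.
[cite: BierstoneGrigorievMilmanWlodarczyk2011, Def. 3.1.3; §4 Step 2b] [cite: Hauser2010, §§F–G]
[cite: HauserPerlega2019PRIMS, §2 (permissible centres P = (z, x_i : i ∈ Γ))]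
[cite: Hironaka1964, Main Theorem I (the characteristic-zero statement whose analogue is asked)] -/
theorem exists_isMarkedResolution_joint_root [IsAlgClosed K] [DecidableEq K] (F : MvPolynomial (Fin 4) K)
    (hF : F ≠ 0) (hclean : Literature.Barriers.ResolutionOfSingularities.HauserPerlega.IsClean p F)
    (mem : Finset ((Fin 4 → K) × Finset (Fin 4)))
    (hmem : ∀ bS ∈ mem, IsPermissibleCentre p bS.2 (deletePthPowers p (PointBlowup.translate bS.1 F)) ∧
      {jb : Fin 4 × (Fin 4 → K) | jb.1 ∈ bS.2 ∧ jb.2 jb.1 = 0 ∧ CentreBlowup.IsEquimultiplePoint p bS.2 jb.1 jb.2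
        (⟨deletePthPowers p (PointBlowup.translate bS.1 F), 0, ∅⟩ : State K)}.Finite ∧
      ∀ (j : Fin 4) (b' : Fin 4 → K), j ∈ bS.2 → b' j = 0 →
        CentreBlowup.IsEquimultiplePoint p bS.2 j b' (⟨deletePthPowers p (PointBlowup.translate bS.1 F), 0, ∅⟩ : State K) →
        Acc (fun s' s : State K => Edge p Finset.univ s s')
            (CentreBlowup.step p bS.2 j b' (⟨deletePthPowers p (PointBlowup.translate bS.1 F), 0, ∅⟩ : State K)) ∧
          ∀ s' : State K, Relation.ReflTransGen (fun a e : State K => Edge p Finset.univ a e)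
              (CentreBlowup.step p bS.2 j b' (⟨deletePthPowers p (PointBlowup.translate bS.1 F), 0, ∅⟩ : State K)) s' →
            {jb : Fin 4 × (Fin 4 → K) | jb.2 jb.1 = 0 ∧
              CentreBlowup.IsEquimultiplePoint p Finset.univ jb.1 jb.2 s'}.Finite)
    (hsep : ∀ bS ∈ mem, ∀ bS' ∈ mem, bS ≠ bS' → ∃ i ∈ bS.2, i ∈ bS'.2 ∧ bS.1 i ≠ bS'.1 i)
    (hroots : {b' : Fin 4 → K | (∀ d : Fin 4 →₀ ℕ, d ≠ 0 → d.degree < p →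
        coeff d (PointBlowup.translate b' F) = 0) ∧ ∀ bS ∈ mem, ¬ ∀ i ∈ bS.2, b' i = bS.1 i}.Finite)
    (hwalk₀ : ∀ b' : Fin 4 → K, (∀ d : Fin 4 →₀ ℕ, d ≠ 0 → d.degree < p → coeff d (PointBlowup.translate b' F) = 0) →
      (∀ bS ∈ mem, ¬ ∀ i ∈ bS.2, b' i = bS.1 i) →
      Acc (fun s' s : State K => Edge p Finset.univ s s')
          (⟨deletePthPowers p (PointBlowup.translate b' F), 0, ∅⟩ : State K) ∧
        ∀ s' : State K, Relation.ReflTransGen (fun a e : State K => Edge p Finset.univ a e)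
            (⟨deletePthPowers p (PointBlowup.translate b' F), 0, ∅⟩ : State K) s' →
          {jb : Fin 4 × (Fin 4 → K) | jb.2 jb.1 = 0 ∧
            CentreBlowup.IsEquimultiplePoint p Finset.univ jb.1 jb.2 s'}.Finite) :
    ∃ (X' : Scheme.{0}) (ρ : X' ⟶ P 4 K) (M' : MarkedIdeal X'),
      IsMarkedResolution (⟨hypSheaf p F, [], p⟩ : MarkedIdeal (P 4 K)) ρ M' := by
  classical
  haveI : PerfectRing K p := PerfectRing.ofSurjective K p fun x => IsAlgClosed.exists_pow_nat_eq x hp.out.pos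
  set M₀ : MarkedIdeal (P 4 K) := ⟨hypSheaf p F, [], p⟩ with hM₀
  have hE₀ : HasSNC M₀.boundary :=
    hasSNC_nil_of_isRegular (Literature.AlgebraicGeometry.Hironaka2017.Lib.AffinePointBlowupLSB.isRegular_Z 4 K)
  -- the coordinate members
  let cof : (Fin 4 → K) × Finset (Fin 4) → Closeds (P 4 K) := fun bS =>
    if h : bS ∈ mem then (root_member_package (p := p) F bS.1 (hmem bS h).1).choose else ⊥
  have hcof : ∀ bS (h : bS ∈ mem), cof bS = (root_member_package (p := p) F bS.1 (hmem bS h).1).choose :=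
    fun bS h => dif_pos h
  set cms : Finset (Closeds (P 4 K)) := mem.image cof with hcms
  let rep : Closeds (P 4 K) → (Fin 4 → K) × Finset (Fin 4) := fun c =>
    if h : ∃ bS ∈ mem, cof bS = c then h.choose else ((0 : Fin 4 → K), (∅ : Finset (Fin 4)))
  have hrep : ∀ c ∈ cms, rep c ∈ mem ∧ cof (rep c) = c := by
    intro c hc
    have h : ∃ bS ∈ mem, cof bS = c := by simpa [hcms, Finset.mem_image] using hc
    have hr : rep c = h.choose := dif_pos h
    rw [hr]
    exact h.choose_spec
  set cst : Closeds (P 4 K) → State K := fun c => ⟨deletePthPowers p (PointBlowup.translate (rep c).1 F), 0, ∅⟩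
    with hcst
  set ctr : Closeds (P 4 K) → Finset (Fin 4) := fun c => (rep c).2 with hctr
  -- coordinate description of the members
  have hin : ∀ c ∈ cms, ∀ z : P 4 K, z ∈ (c : Set (P 4 K)) → ∀ i ∈ (rep c).2, (X i.succ - C ((rep c).1 i) : A 4 K) ∈ z.asIdeal := by
    intro c hc z hz
    obtain ⟨hr, hcr⟩ := hrep c hc
    have hspec := (root_member_package (p := p) F (rep c).1 (hmem _ hr).1).choose_spec
    rw [← hcof _ hr, hcr] at hspec
    exact hspec.2.2.2.1 z hz
  have hon : ∀ bS ∈ mem, ∀ z : P 4 K, IsClosed ({z} : Set (P 4 K)) → (1 : ℕ∞) ≤ idealOrder (hypSheaf p F) z →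
      (∀ i ∈ bS.2, (X i.succ - C (bS.1 i) : A 4 K) ∈ z.asIdeal) → z ∈ (cof bS : Set (P 4 K)) := by
    intro bS h z hzc hord hzS
    rw [hcof bS h]
    exact (root_member_package (p := p) F bS.1 (hmem bS h).1).choose_spec.2.2.2.2 z hzc hord hzS
  -- the point members: closed order-`p` points off every member
  have hfin₀ : {z : P 4 K | IsClosed ({z} : Set (P 4 K)) ∧ (p : ℕ∞) ≤ idealOrder (hypSheaf p F) z ∧
      ∀ c ∈ cms, z ∉ (c : Set (P 4 K))}.Finite := by
    let pt : (Fin (4 + 1) → K) → P 4 K := fun v => ⟨MvPolynomial.vanishingIdeal K {v}, inferInstance⟩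
    let g : (Fin 4 → K) → P 4 K := fun b => pt (Fin.cons ((frobeniusEquiv K p).symm (-MvPolynomial.eval b F)) b)
    refine (hroots.image g).subset fun z hz => ?_
    obtain ⟨hzc, hord, hzoff⟩ := hz
    obtain ⟨a', b', hzab⟩ := exists_eq_vanishingIdeal_cons_of_isClosed hzc
    have hord' := (natCast_le_idealOrder_hypSheaf_iff (p := p) F hzab p).mp hord
    rw [natCast_le_ordZero_translate_hyp_iff] at hord'
    obtain ⟨hab, H⟩ := hord'
    have ha : (frobeniusEquiv K p).symm (-MvPolynomial.eval b' F) = a' := by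
      apply (frobeniusEquiv K p).injective
      rw [RingEquiv.apply_symm_apply, frobeniusEquiv_def]
      exact (eq_neg_of_add_eq_zero_left hab).symm
    refine ⟨b', ⟨H, fun bS hbS hall => hzoff (cof bS) (Finset.mem_image_of_mem cof hbS) ?_⟩, ?_⟩
    · exact hon bS hbS z hzc (le_trans (by exact_mod_cast hp.out.one_lt.le) hord)
        fun i hi => (X_succ_sub_C_mem_asIdeal_iff i _ a' b' hzab).mpr (hall i hi)
    · apply PrimeSpectrum.ext
      change MvPolynomial.vanishingIdeal K {(Fin.cons ((frobeniusEquiv K p).symm (-MvPolynomial.eval b' F)) b' :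
        Fin (4 + 1) → K)} = z.asIdeal
      rw [ha, hzab]
  set pts : Finset (P 4 K) := hfin₀.toFinset with hpts
  have hmem_pts : ∀ z : P 4 K, z ∈ pts ↔ IsClosed ({z} : Set (P 4 K)) ∧ (p : ℕ∞) ≤ idealOrder (hypSheaf p F) z ∧
      ∀ c ∈ cms, z ∉ (c : Set (P 4 K)) := fun z => by rw [hpts, Set.Finite.mem_toFinset, Set.mem_setOf_eq]
  set st : P 4 K → State K := fun z =>
    if hz : IsClosed ({z} : Set (P 4 K)) then
      ⟨deletePthPowers p (PointBlowup.translate (exists_eq_vanishingIdeal_cons_of_isClosed hz).choose_spec.choose F),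
        0, ∅⟩
    else ⟨F, 0, ∅⟩ with hst
  refine exists_isMarkedResolution_of_joint_config M₀ hE₀ rfl cms.card (P 4 K) (𝟙 _) M₀ (IsMultipleBlowup.refl M₀)
    pts st (fun z hz => ((hmem_pts z).mp hz).1) (fun z hz => ?_) cms rfl cst ctr (fun c hc => ?_)
    (fun c hc c' hc' hcc => ?_) (fun z hz c hc => ((hmem_pts z).mp hz).2.2 c hc) (fun z hz hzo => ?_)
  · -- data of the point members (typ-3 g2's root charts)
    obtain ⟨hzc, hord, hzoff⟩ := (hmem_pts z).mp hz
    set a := (exists_eq_vanishingIdeal_cons_of_isClosed hzc).choose with ha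
    set b := (exists_eq_vanishingIdeal_cons_of_isClosed hzc).choose_spec.choose with hb
    have hzab : z.asIdeal = MvPolynomial.vanishingIdeal K {(Fin.cons a b : Fin (4 + 1) → K)} :=
      (exists_eq_vanishingIdeal_cons_of_isClosed hzc).choose_spec.choose_spec
    have hstz : st z = ⟨deletePthPowers p (PointBlowup.translate b F), 0, ∅⟩ := by rw [hst]; exact dif_pos hzc
    have hord' := (natCast_le_idealOrder_hypSheaf_iff (p := p) F hzab p).mp hord
    rw [natCast_le_ordZero_translate_hyp_iff] at hord'
    obtain ⟨hab, H⟩ := hord'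
    have hoff : ∀ bS ∈ mem, ¬ ∀ i ∈ bS.2, b i = bS.1 i := fun bS hbS hall =>
      hzoff (cof bS) (Finset.mem_image_of_mem cof hbS) (hon bS hbS z hzc
        (le_trans (by exact_mod_cast hp.out.one_lt.le) hord)
        fun i hi => (X_succ_sub_C_mem_asIdeal_iff i _ a b hzab).mpr (hall i hi))
    obtain ⟨φ, _, hφ, hMφ⟩ := exists_chart_recenter (p := p) F a b hab hzab
    obtain ⟨hacc, hloc⟩ := hwalk₀ b H hoff
    rw [hstz]
    refine ⟨deletePthPowers_translate_ne_zero hF hclean b, isClean_deletePthPowers _,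
      ordAlong_univ_deletePthPowers_translate F b H, hacc, fun s' hs' => ?_, P 4 K, φ, 𝟙 _, inferInstance,
      inferInstance, ξ 4 K, hφ, rfl, by rw [Scheme.IdealSheafData.comap_id]; exact hMφ⟩
    exact finite_closedOver_model_of_finite_pairs s'
      (ordAlong_univ_of_reflTransGen_edge (ordAlong_univ_deletePthPowers_translate F b H) hs') (hloc s' hs')
  · -- data of the coordinate members
    obtain ⟨hr, hcr⟩ := hrep c hc
    obtain ⟨hS, hfin, hwalk⟩ := hmem _ hr
    have hspec := (root_member_package (p := p) F (rep c).1 hS).choose_spec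
    rw [← hcof _ hr, hcr] at hspec
    obtain ⟨hreg, hsnc, hzig, -, -⟩ := hspec
    exact ⟨deletePthPowers_translate_ne_zero hF hclean _, isClean_deletePthPowers _, hS, hreg, hsnc, hfin, hwalk, hzig⟩
  · -- the members are pairwise disjoint (separated parameters)
    obtain ⟨hr, hcr⟩ := hrep c hc
    obtain ⟨hr', hcr'⟩ := hrep c' hc'
    have hne : rep c ≠ rep c' := fun h => hcc (by rw [← hcr, ← hcr', h])
    obtain ⟨i, hi, hi', hb⟩ := hsep _ hr _ hr' hne
    rw [Set.disjoint_left]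
    intro z hz hz'
    have h1 := hin c hc z hz i hi
    have h2 := hin c' hc' z hz' i hi'
    have h3 : (C ((rep c').1 i - (rep c).1 i) : A 4 K) ∈ z.asIdeal := by
      have h := z.asIdeal.sub_mem h1 h2
      rwa [sub_sub_sub_cancel_left, ← map_sub] at h
    exact z.2.ne_top (z.asIdeal.eq_top_of_isUnit_mem h3
      ((isUnit_iff_ne_zero.mpr (sub_ne_zero.mpr (Ne.symm hb))).map C))
  · -- every closed order-`p` point is a member
    by_cases h : ∃ c ∈ cms, z ∈ (c : Set (P 4 K))
    · exact Or.inr h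
    · push Not at h
      exact Or.inl ((hmem_pts z).mpr ⟨hz, hzo, h⟩)

end Root

end Equimultiple

end Summit.ResolutionOfSingularities.ResolutionOfSingularities.Theorems.PIDim4

end
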